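import Summits.ResolutionOfSingularities.ResolutionOfSingularities.Theorems.DescentDescentPerfectToAllSeparableBaseChange

/-!
# `DescentPerfectToAll` (stmt-ResolutionOfSingularities-0549): closure properties of the class of
# ground fields over which resolution holds

Route `ResolutionOfSingularities/Descent`, crux `DescentPerfectToAll` (perfect ⇒ all ground fields of
characteristic `p`). Helper file (OURS; `--supports` the crux, does not close it; NOT a statement of
any manuscript). Write `Res(k)` for "every reduced separated `k`-scheme of finite type has a
resolution of singularities" (kept INLINE as a hypothesis, no new definition). The crux says
`(∀ perfect k, Res(k)) → ∀ k, Res(k)`. This file records, sorry-free, the two closure properties of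
the class `{k : Res(k)}` that the tree's mechanisms give, each in its natural generality:

* `hasResolution_of_resOver_of_essFiniteType` — **closure under finitely generated extensions**
  (characteristic free): `Res(k₀) → Res(k)` for every field `k` essentially of finite type over
  `k₀`. Spreading out over a finitely generated `k₀`-subalgebra `R' ⊆ k` with `Frac R' = k`,
  resolving the reduction of the model over `k₀`, generic fibre. This is the proof of the tree's
  `hasResolution_of_perfectRes_of_essFiniteType` (lead c5, `k₀` perfect) run verbatim for an
  arbitrary resolvable `k₀`: perfectness of `k₀` was used there only to invoke the antecedent.
* `hasResolution_of_resOver_of_isSeparable` — **closure under separable algebraic extensions**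
  (characteristic `p`): `Res(K) → Res(k)` for `k/K` separable algebraic (`K ⊆ k` a subfield).
  A given `X/k` is defined over a finitely generated `K₀ = closure s`; the level `K(s)` is
  resolvable by the first closure property, `k/K(s)` is separable algebraic, and resolutions
  ascend along separable extensions (`hasResolution_pullback_subtype_of_linearIndepOn_pow`,
  `DescentDescentPerfectToAllSeparableBaseChange.lean`).
* `hasResolution_of_resOver_tower` — the two combined: `Res(k₀) → Res(k)` whenever
  `k₀ → K ⊆ k` with `K/k₀` essentially of finite type and `k/K` separable algebraic; with `k₀`
  perfect this is `hasResolution_of_perfectRes_of_isSeparable_essFiniteType`.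

So under the antecedent of the crux the resolvable ground fields contain every field reached from a
perfect field by finitely many steps "finitely generated extension" / "separable algebraic
extension". The residual of the crux is what these steps never reach: a ground field inseparable
over every field of definition of the given scheme (`𝔽_p(t,s) ⊆ 𝔽_p((t))`, MacLane).
-/

noncomputable section

set_option linter.dupNamespace false -- mandated namespace of this single-conjunct summit

namespace Summit.ResolutionOfSingularities.ResolutionOfSingularities.Theorems

open CategoryTheory CategoryTheory.Limits AlgebraicGeometry MonoidalCategory Opposite TopologicalSpace
open Literature.AlgebraicGeometry.Limits Literature.AlgebraicGeometry.Morphisms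
open Literature.AlgebraicGeometry.Resolution
open Literature.AlgebraicGeometry.Motives (SchemeOver specOver)

-- As in `Literature/AlgebraicGeometry/Limits/SubalgebraDiagram.lean` and `ClosedSubschemes.lean`: the
-- cone legs `c.π.app i` have source `((Functor.const _).obj c.pt).obj i`, definitionally `c.pt`.
set_option backward.isDefEq.respectTransparency false

universe u

/-! ## Closure under finitely generated extensions of the ground field -/

/-- **Resolution over `k₀` ⇒ resolution over every field essentially of finite type over `k₀`**
(any characteristic). If every reduced separated scheme of finite type over the field `k₀` admits a
resolution of singularities, then so does every reduced separated scheme of finite type over any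
field `k` which is a finitely generated field extension (`Algebra.EssFiniteType`) of `k₀`: spread
`X` out to a model over a finitely generated `k₀`-subalgebra `R' ⊆ k` with `Frac R' = k`, resolve
the reduction of the model (a reduced separated `k₀`-scheme of finite type), and take the generic
fibre (`Spec k → Spec R'` is a flat preimmersion). The proof is that of
`hasResolution_of_perfectRes_of_essFiniteType` with the perfect base replaced by any resolvable
one. [cite: EGAIV3, Thm. 8.8.2] -/
theorem hasResolution_of_resOver_of_essFiniteType : ∀ (k₀ k : Type) [Field k₀] [Field k] [Algebra k₀ k], (∀ (Z : Scheme.{0}) (h : Z ⟶ Spec (.of k₀)), IsSeparated h → LocallyOfFiniteType h → QuasiCompact h → IsReduced Z → Scheme.HasResolution Z) → Algebra.EssFiniteType k₀ k → ∀ (X : Scheme.{0}) (f : X ⟶ Spec (.of k)), IsSeparated f → LocallyOfFiniteType f → QuasiCompact f → IsReduced X → Scheme.HasResolution X := by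
  intro k₀ k _ _ _ H hess X f hsep hlft hqc hred
  classical
  -- generators: `k = Frac k₀[σ]`
  obtain ⟨σ, hσ⟩ := (Algebra.essFiniteType_iff k₀ k).mp hess
  -- ### Step 1: a closed `k`-immersion into a finite type model over a finitely generated subring
  obtain ⟨A₀, _, φ, Y₀, p₀, j, hNoeth, hfgA, -, hpsep, hplft, hpqc, hj, hjg⟩ :=
    exists_finiteTypeModel f
  letI : Algebra A₀ k := φ.toAlgebra
  haveI := hNoeth
  let P : SchemeOver A₀ := Over.mk p₀
  haveI : IsSeparated P.hom := hpsep
  haveI : QuasiCompact P.hom := hpqc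
  haveI : LocallyOfFiniteType P.hom := hplft
  let jY : X ⟶ (P ⊗ specOver A₀ k).left := j
  haveI : IsClosedImmersion jY := hj
  have hg : jY ≫ pullback.snd P.hom (specOver A₀ k).hom = f := hjg
  -- ### Step 2: the closed subscheme `X` descends to a stage `R = A₀[t'] ⊆ k`, `σ ⊆ t'`
  haveI : IsLocallyNoetherian (SubalgApprox.prodCone A₀ k σ P).pt := by
    haveI : IsLocallyNoetherian (specOver A₀ k).left :=
      inferInstanceAs (IsLocallyNoetherian (Spec (.of k)))
    change IsLocallyNoetherian (pullback P.hom (specOver A₀ k).hom)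
    exact LocallyOfFiniteType.isLocallyNoetherian (pullback.snd P.hom (specOver A₀ k).hom)
  obtain ⟨i, hi⟩ := exists_isPullback_toImage_of_isLocallyNoetherian
    (SubalgApprox.prodDiagram A₀ k σ P) (SubalgApprox.prodCone A₀ k σ P)
    (SubalgApprox.isLimitProdCone A₀ k σ P) jY
  have HX := hi i (𝟙 i)
  let R : Subalgebra A₀ k := SubalgApprox.sub A₀ k i.unop.1
  let π : (P ⊗ specOver A₀ k).left ⟶ (SubalgApprox.prodDiagram A₀ k σ P).obj i :=
    (SubalgApprox.prodCone A₀ k σ P).π.app i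
  have Hleg : IsPullback π (pullback.snd P.hom (specOver A₀ k).hom)
      (pullback.snd P.hom (specOver A₀ R).hom)
      (Spec.map (CommRingCat.ofHom (algebraMap R k))) :=
    SubalgApprox.isPullback_whiskerLeft_left P ((SubalgApprox.baseCone A₀ k σ).π.app i)
  let Xt : Scheme.{0} := (jY ≫ π).image
  let πt : X ⟶ Xt := (jY ≫ π).toImage
  let ft : Xt ⟶ Spec (.of R) := (jY ≫ π).imageι ≫ pullback.snd P.hom (specOver A₀ R).hom
  let s : Spec (.of k) ⟶ Spec (.of R) := Spec.map (CommRingCat.ofHom (algebraMap R k))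
  have Hmain : IsPullback πt f ft s := by
    have h := HX.flip.paste_vert Hleg
    rwa [hg] at h
  haveI : IsSeparated ft := inferInstance
  haveI : LocallyOfFiniteType ft := inferInstance
  haveI : QuasiCompact ft := inferInstance
  -- ### Step 3: enlarge the base to the finitely generated `k₀`-subalgebra `R' = k₀[φ(G) ∪ t'] ⊇ R`
  obtain ⟨G, hG⟩ := hfgA.out
  let S : Finset k := G.image φ ∪ i.unop.1
  let R' : Subalgebra k₀ k := Algebra.adjoin k₀ (↑S : Set k)
  have hφR' : ∀ a : A₀, φ a ∈ R' := by
    intro a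
    have ha : a ∈ Algebra.adjoin ℤ (G : Set A₀) := by rw [hG]; exact Algebra.mem_top
    rw [Algebra.adjoin_int, mem_subalgebraOfSubring] at ha
    have hφa : φ a ∈ (Subring.closure (G : Set A₀)).map φ := Subring.mem_map.mpr ⟨a, ha, rfl⟩
    rw [RingHom.map_closure] at hφa
    refine (Subring.closure_le.mpr ?_ : Subring.closure (φ '' (G : Set A₀)) ≤ R'.toSubring) hφa
    rintro _ ⟨g, hg, rfl⟩
    exact Algebra.subset_adjoin (Finset.mem_coe.2
      (Finset.mem_union_left _ (Finset.mem_image_of_mem φ (Finset.mem_coe.1 hg))))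
  have hRR' : ∀ x : k, x ∈ R → x ∈ R' := by
    intro x hx
    have hle : Subring.closure (Set.range (algebraMap A₀ k) ∪ (↑(i.unop.1) : Set k)) ≤ R'.toSubring :=
      Subring.closure_le.mpr (by
        rintro y (⟨a, rfl⟩ | hy)
        · exact Subalgebra.mem_toSubring.mpr (hφR' a)
        · exact Subalgebra.mem_toSubring.mpr (Algebra.subset_adjoin
            (Finset.mem_coe.2 (Finset.mem_union_right _ (Finset.mem_coe.1 hy)))))
    exact Subalgebra.mem_toSubring.mp (hle (Algebra.mem_adjoin_iff.mp hx))
  have hσR' : ∀ x : k, x ∈ Algebra.adjoin k₀ (↑σ : Set k) → x ∈ R' := fun x hx =>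
    (Algebra.adjoin_mono (fun y hy => Finset.mem_coe.2
      (Finset.mem_union_right _ (i.unop.2 (Finset.mem_coe.1 hy)))) : Algebra.adjoin k₀ (↑σ : Set k) ≤ R') hx
  let ι : R →+* R' := (R.val.toRingHom).codRestrict R' fun x => hRR' x.1 x.2
  have hι : (algebraMap R' k).comp ι = algebraMap R k := RingHom.ext fun _ => rfl
  let g₀ : Spec (.of R') ⟶ Spec (.of R) := Spec.map (CommRingCat.ofHom ι)
  let s' : Spec (.of k) ⟶ Spec (.of R') := Spec.map (CommRingCat.ofHom (algebraMap R' k))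
  have hs' : s' ≫ g₀ = s := by
    rw [← Spec.map_comp, ← CommRingCat.ofHom_comp, hι]
  -- the model `V = X_R ×_R Spec R'` over `R'`, with `X ≅ V ×_{R'} Spec k`
  let V : Scheme.{0} := pullback ft g₀
  let ft' : V ⟶ Spec (.of R') := pullback.snd ft g₀
  have hw : πt ≫ ft = (f ≫ s') ≫ g₀ := by rw [Category.assoc, hs']; exact Hmain.w
  let c : X ⟶ V := pullback.lift πt (f ≫ s') hw
  have hc₁ : c ≫ pullback.fst ft g₀ = πt := pullback.lift_fst _ _ _
  have hc₂ : c ≫ ft' = f ≫ s' := pullback.lift_snd _ _ _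
  have hbig : IsPullback (c ≫ pullback.fst ft g₀) f ft (s' ≫ g₀) := by
    rw [hc₁, hs']; exact Hmain
  have T : IsPullback c f ft' s' := hbig.of_right hc₂ (IsPullback.of_hasPullback ft g₀)
  -- ### Step 4: `R'` is of finite type over the resolvable field `k₀`: resolve the reduction `V_red`
  let b : Spec (.of R') ⟶ Spec (.of k₀) := Spec.map (CommRingCat.ofHom (algebraMap k₀ R'))
  haveI : LocallyOfFiniteType b := by
    rw [HasRingHomProperty.Spec_iff (P := @LocallyOfFiniteType)]
    exact RingHom.finiteType_algebraMap.mpr inferInstance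
  haveI : IsSeparated (ft' ≫ b) := inferInstance
  haveI : LocallyOfFiniteType (ft' ≫ b) := inferInstance
  haveI : QuasiCompact (ft' ≫ b) := inferInstance
  obtain ⟨Y, πr, hres⟩ := hasResolution_nilradical_subscheme (ft' ≫ b) H
  -- ### Step 5: `k = Frac R'`, so `Spec k → Spec R'` is a flat preimmersion
  have hsurj : ∀ z : k, ∃ x y : R', z = algebraMap R' k x / algebraMap R' k y := by
    intro z
    obtain ⟨t, ht, htu, hzt⟩ := hσ z
    refine ⟨⟨z * t, hσR' _ hzt⟩, ⟨t, hσR' _ ht⟩, ?_⟩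
    change z = z * t / t
    rw [mul_div_assoc, div_self htu.ne_zero, mul_one]
  haveI : IsFractionRing R' k := IsFractionRing.of_field R' k hsurj
  haveI : IsPreimmersion s' := IsPreimmersion.of_isLocalization (nonZeroDivisors R')
  haveI : Flat s' := by
    rw [Flat.SpecMap_iff, CommRingCat.hom_ofHom]
    exact RingHom.flat_algebraMap_iff.mpr (IsLocalization.flat k (nonZeroDivisors R'))
  -- ### Step 6: the generic fibre of the resolution of `V_red` resolves `V_red ×_{R'} Spec k`, i.e. `X`
  haveI := hres.isProper
  haveI : IsNoetherian V.nilradical.subscheme :=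
    Scheme.isNoetherian_of_finiteType_over_field (V.nilradical.subschemeι ≫ ft' ≫ b)
  haveI : IsNoetherian Y :=
    Scheme.isNoetherian_of_finiteType_over_field (πr ≫ V.nilradical.subschemeι ≫ ft' ≫ b)
  haveI := hred
  exact hasResolution_of_hasResolution_pullback_nilradical T
    (hasResolution_pullback_of_flat_of_surjectiveOnStalks (V.nilradical.subschemeι ≫ ft') s' πr hres)

/-! ## Closure under separable algebraic extensions of the ground field -/

/-- **Resolution over `K` ⇒ resolution over every separable algebraic extension of `K`**
(characteristic `p`; `K ⊆ k` a subfield over which `k` is separable algebraic). If every reduced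
separated scheme of finite type over `K` has a resolution, so does every reduced separated scheme of
finite type `X` over `k`: `X` is defined over a finitely generated `K₀ = closure s`
(`stub_fgModel`), the level `E = K(s)` is resolvable (`hasResolution_of_resOver_of_essFiniteType`),
`k/E` is again separable algebraic, hence MacLane-separable, and the resolution of `X₀ ×_{K₀} E`
base-changes to one of `X₀ ×_{K₀} k ≅ X` (`hasResolution_pullback_subtype_of_linearIndepOn_pow`).
[cite: EGAIV2, Prop. 6.7.4] -/
theorem hasResolution_of_resOver_of_isSeparable (p : ℕ) [Fact p.Prime] (k : Type) [Field k]
    [CharP k p] (K : Subfield k)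
    (HK : ∀ (Z : Scheme.{0}) (h : Z ⟶ Spec (.of K)), IsSeparated h → LocallyOfFiniteType h →
      QuasiCompact h → IsReduced Z → Scheme.HasResolution Z)
    [Algebra.IsSeparable K k] (X : Scheme.{0}) (f : X ⟶ Spec (.of k)) [IsSeparated f]
    [LocallyOfFiniteType f] [QuasiCompact f] [IsReduced X] : Scheme.HasResolution X := by
  classical
  -- finitely generated field of definition (`stub_fgModel`)
  obtain ⟨K₀, s, hK₀, X₀, f₀, h₁, h₂, h₃, h₄, ⟨e⟩⟩ := stub_fgModel k X f ‹_› ‹_› ‹_› ‹_›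
  haveI := h₁; haveI := h₂; haveI := h₃; haveI := h₄
  haveI : IsReduced (pullback f₀ (Spec.map (CommRingCat.ofHom K₀.subtype))) :=
    isReduced_of_isOpenImmersion e.inv
  -- the level `E = K(s)`, as a subfield of `k`
  set E : Subfield k := (IntermediateField.adjoin K (↑s : Set k)).toSubfield with hEdef
  have hKE : K ≤ E := fun x hx =>
    (IntermediateField.adjoin K (↑s : Set k)).algebraMap_mem ⟨x, hx⟩
  have hK₀E : K₀ ≤ E := by
    rw [hK₀, Subfield.closure_le]
    exact fun x hx => IntermediateField.subset_adjoin K _ hx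
  letI : Algebra K E := (Subfield.inclusion hKE).toAlgebra
  haveI : IsScalarTower K E k := IsScalarTower.of_algebraMap_eq fun _ => rfl
  have hKEess : Algebra.EssFiniteType K E := essFiniteType_of_eq_adjoin_toSubfield K E s hEdef
  -- the level `X₀ ×_{K₀} E` is reduced and resolvable
  set ι₁ := Spec.map (CommRingCat.ofHom (Subfield.inclusion hK₀E)) with hι₁
  haveI : IsReduced (pullback f₀ ι₁) := isReduced_pullback_inclusion K₀ E hK₀E f₀
  have hresE : Scheme.HasResolution (pullback f₀ ι₁) :=
    hasResolution_of_resOver_of_essFiniteType K E HK hKEess _ (pullback.snd f₀ ι₁)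
      inferInstance inferInstance inferInstance inferInstance
  -- `k/E` is separable algebraic, hence MacLane-separable; ascend
  haveI : Algebra.IsSeparable E k := Algebra.isSeparable_tower_top_of_isSeparable K E k
  have hML : ∀ u : Finset k, LinearIndepOn E _root_.id (↑u : Set k) →
      LinearIndepOn E (fun x : k => x ^ p) (↑u : Set k) :=
    fun u hu => linearIndepOn_pow_of_isSeparable E u hu
  haveI : ExpChar k p := ExpChar.prime (Fact.out : p.Prime)
  have hk := hasResolution_pullback_subtype_of_linearIndepOn_pow p Fact.out E hML
    (pullback.snd f₀ ι₁) hresE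
  -- transport along `(X₀ ×_{K₀} E) ×_E k ≅ X₀ ×_{K₀} k ≅ X`
  have hcomp : E.subtype.comp (Subfield.inclusion hK₀E) = K₀.subtype := RingHom.ext fun _ => rfl
  have ecomp : Spec.map (CommRingCat.ofHom E.subtype) ≫ ι₁ =
      Spec.map (CommRingCat.ofHom K₀.subtype) := by
    rw [hι₁, ← Spec.map_comp, ← CommRingCat.ofHom_comp, hcomp]
  exact (hk.of_iso (pullbackLeftPullbackSndIso f₀ ι₁ (Spec.map (CommRingCat.ofHom E.subtype)) ≪≫
    pullback.congrHom rfl ecomp).hom).of_iso e.inv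

/-- **The two steps combined.** If every reduced separated scheme of finite type over `k₀` has a
resolution, `K ⊆ k` is a subfield essentially of finite type over `k₀` (along some `k₀ → K`), and
`k/K` is separable algebraic, then every reduced separated `k`-scheme of finite type has a
resolution of singularities. With `k₀` perfect and the antecedent of the crux this is
`hasResolution_of_perfectRes_of_isSeparable_essFiniteType`. [folklore] -/
theorem hasResolution_of_resOver_tower (p : ℕ) [Fact p.Prime] (k₀ : Type) [Field k₀]
    (H₀ : ∀ (Z : Scheme.{0}) (h : Z ⟶ Spec (.of k₀)), IsSeparated h → LocallyOfFiniteType h →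
      QuasiCompact h → IsReduced Z → Scheme.HasResolution Z)
    (k : Type) [Field k] [CharP k p] (K : Subfield k) [Algebra k₀ K]
    (hK : Algebra.EssFiniteType k₀ K) [Algebra.IsSeparable K k]
    (X : Scheme.{0}) (f : X ⟶ Spec (.of k)) [IsSeparated f] [LocallyOfFiniteType f]
    [QuasiCompact f] [IsReduced X] : Scheme.HasResolution X :=
  hasResolution_of_resOver_of_isSeparable p k K
    (fun Z h a b c d => hasResolution_of_resOver_of_essFiniteType k₀ K H₀ hK Z h a b c d) X f

/-- **Iterated towers.** The class of ground fields over which resolution holds is closed under the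
two steps, so it is closed under any finite alternation of them: if resolution holds over `k₀`,
and `k₀ → K₁ ⊆ k₁` with `K₁/k₀` essentially of finite type and `k₁/K₁` separable algebraic, and
again `k₁ → K₂ ⊆ k₂` with `K₂/k₁` essentially of finite type and `k₂/K₂` separable algebraic, then
resolution holds over `k₂` (and so on). [folklore] -/
theorem hasResolution_of_resOver_tower₂ (p : ℕ) [Fact p.Prime] (k₀ : Type) [Field k₀]
    (H₀ : ∀ (Z : Scheme.{0}) (h : Z ⟶ Spec (.of k₀)), IsSeparated h → LocallyOfFiniteType h →
      QuasiCompact h → IsReduced Z → Scheme.HasResolution Z)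
    (k₁ : Type) [Field k₁] [CharP k₁ p] (K₁ : Subfield k₁) [Algebra k₀ K₁]
    (hK₁ : Algebra.EssFiniteType k₀ K₁) [Algebra.IsSeparable K₁ k₁]
    (k₂ : Type) [Field k₂] [CharP k₂ p] (K₂ : Subfield k₂) [Algebra k₁ K₂]
    (hK₂ : Algebra.EssFiniteType k₁ K₂) [Algebra.IsSeparable K₂ k₂]
    (X : Scheme.{0}) (f : X ⟶ Spec (.of k₂)) [IsSeparated f] [LocallyOfFiniteType f]
    [QuasiCompact f] [IsReduced X] : Scheme.HasResolution X :=
  hasResolution_of_resOver_tower p k₁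
    (fun Z h a b c d => by
      haveI := a; haveI := b; haveI := c; haveI := d
      exact hasResolution_of_resOver_tower p k₀ H₀ k₁ K₁ hK₁ Z h)
    k₂ K₂ hK₂ X f

end Summit.ResolutionOfSingularities.ResolutionOfSingularities.Theorems

end
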